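import Mathlib
import HarnessLib
import Literature.Analysis.Convex.SchauderFixedPoint
import Literature.Analysis.ValidatedNumerics.RumpLinearSystemVerification
import Literature.LinearAlgebra.Matrix.SpectralRadiusMonotone

/-!
# Rump's verification theorem for eigenvalue clusters and invariant subspaces (Acta Numerica 2010, Thm 13.9)

Topic `Literature/Analysis/ValidatedNumerics`, namespace
`Literature.Analysis.ValidatedNumerics.RumpEigenCluster`.  Cell certnum (CERTIFIED-NUMERICS STACK,
D-0105 (6)), layer L4: the Lean soundness statement behind INTLAB's `verifyeig` for a CLUSTER of `k`
eigenvalues / a `k`-dimensional invariant subspace of a general (not necessarily symmetric) real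
matrix (the `k = 1` case, a simple eigenpair, is the tree's
`Literature.Analysis.ValidatedNumerics.krawczyk_eigenpair`).
HONEST FRAMING: this file types and PROVES «inclusion test passed ⇒ an exactly invariant subspace
with basis in `X̃ + UUᵀ𝐗` and representation matrix in `λ̃I + Vᵀ𝐗` exists, the preconditioner and
the bordered matrix are nonsingular, and every (complex) eigenvalue of the representation matrix lies
in an explicit disc»; it certifies no engine output and does not model floating point.
WHAT THIS IS NOT: not the complex-matrix case `K = ℂ` of the printed theorem (real data only); not a
Jordan-form statement (Mathlib has no Jordan canonical form — see «Rendering»); not Gershgorin /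
Perron–Frobenius theory (the disc radius is the Collatz–Wielandt upper bound of `ϱ(|Vᵀ𝐗|)`, not `ϱ`
itself).

SOURCE (read on the page): S. M. Rump, *Verification methods: rigorous results using floating-point
arithmetic*, Acta Numerica 19 (2010) 287–449 [Rump2010Verification], §13.4 «Multiple or clustered
eigenvalues / invariant subspaces»; held copy `paper:url-cae7890f58e7` (author's version `Ru10.pdf`),
PDF pages 169–171 (printed pp. 102–104).  Verbatim:

> [p. 102] `U ∈ ℝ^{n×(n−k)}`, `V ∈ ℝ^{n×k}` … partition of the identity matrix … `UUᵀ + VVᵀ = I_n`,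
> and `VᵀX̃ ∈ K^{k×k}` is the normalizing part of `X̃`. Note that `UᵀU = I_{n−k}` and `VᵀV = I_k`.
> **Theorem 13.9.** Let `A ∈ K^{n×n}`, `X̃ ∈ K^{n×k}`, `λ̃ ∈ K`, `R ∈ K^{n×n}` and `𝐗 ∈ 𝕀K^{n×k}` be
> given, and let `U, V` partition the identity matrix as defined in Figure 13.2. Define
> `f(X) := −R(AX̃ − λ̃X̃) + {I − R((A − λ̃I)UUᵀ − (X̃ + UUᵀ·X)Vᵀ)}·X`. (13.43)
> Suppose `f(𝐗) ⊆ int(𝐗)`. (13.44)  Then there exists `M̂ ∈ K^{k×k}` with `M̂ ∈ λ̃I_k + Vᵀ𝐗` such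
> that the Jordan canonical form of `M̂` is identical to a `k × k` principal submatrix of the Jordan
> canonical form of `A`, and there exists `Ŷ ∈ K^{n×k}` with `Ŷ ∈ X̃ + UUᵀ𝐗` such that `Ŷ` spans
> the corresponding invariant subspace of `A`. We have `AŶ = ŶM̂`.
> *Proof.* The continuous mapping `f : Kⁿ → Kⁿ` defined by (13.43) maps by (13.44) the non-empty,
> convex and compact set `𝐗` into itself. Therefore, Brouwer's Fixed-Point Theorem implies existence
> of a fixed point `X̂ ∈ Kⁿ` with `f(X̂) = X̂` and `X̂ ∈ 𝐗`. Inserting in (13.43) yields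
> `−R{(AX̃ − λ̃X̃) + (A − λ̃I)UUᵀX̂ − (X̃ + UUᵀX̂)VᵀX̂} = 0`. (13.45)  Furthermore, (13.43), (13.44)
> and Lemma 10.5 imply `R` and every matrix within `𝐁 := (A − λ̃I)UUᵀ − (X̃ + UUᵀ·𝐗)Vᵀ ∈ 𝕀K^{n×n}`
> to be non-singular. Collecting terms in (13.45) yields `A(X̃ + UUᵀX̂) = (X̃ + UUᵀX̂)(λ̃I_k + VᵀX̂)`
> or `AŶ = ŶM̂` for `Ŷ := X̃ + UUᵀX̂` and `M̂ := λ̃I_k + VᵀX̂`. Finally,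
> `(A − λ̃I)UUᵀ − (X̃ + UUᵀX̂)Vᵀ ∈ 𝐁` is non-singular and has `k` columns equal to `−Ŷ`.
> Therefore, `Ŷ` has full rank and is a basis for an invariant subspace of `A`. For `M̂ = ZJZ⁻¹`
> denoting the Jordan canonical form, `AŶ = ŶM̂` implies `A(ŶZ) = (ŶZ)J`. The theorem is proved.
> [p. 104] For an interval matrix `𝐂 ∈ K^{k×k}`, denote by `|𝐂| ∈ ℝ^{k×k}` the matrix of the
> entrywise maximum modulus of `𝐂` … Then, for `r := ϱ(|Vᵀ𝐗|)` there are `k` eigenvalues of `A` in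
> `U_r(λ̃) := {z ∈ ℂ : |z − λ̃| ≤ r}`, (13.46) where `ϱ` denotes the spectral radius, in this case the
> Perron root of `|Vᵀ𝐗| ∈ ℝ^{k×k}`, which can be estimated as in (10.61). … To see (13.46), observe
> that for `M̂ = λ̃I_k + M̃`, for some `M̃ ∈ Vᵀ𝐗`, the eigenvalues of `M̂` are the eigenvalues of `M̃`
> shifted by `λ̃`, and for any eigenvalue `μ` of `M̃`, Perron–Frobenius theory implies
> `|μ| ≤ ϱ(M̃) ≤ ϱ(|M̃|) ≤ ϱ(|Vᵀ𝐗|) = r`.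
> [p. 73, (10.61), Collatz 1942] for every positive vector `x ∈ ℝⁿ`, `‖R‖₂ ≤ √μ` with
> `μ := max_i (Rᵀ(Rx))_i / x_i` … Collatz (1942) showed that `μ` is an upper bound for the Perron
> root of (the non-negative matrix) `RᵀR`.

## Rendering and faithfulness
* `K = ℝ`. Index types `n` (matrix size) and `k` (cluster size) are finite types; the partition
  `U, V` of the identity is given by an INJECTIVE selection `v : k → n` of the normalising rows:
  `Vᵀ = vt v := (I_n).submatrix v id ∈ ℝ^{k×n}` (row `c` of `Vᵀ` is the unit vector `e_{v c}`),
  `VVᵀ = (vt v)ᵀ (vt v)` and `UUᵀ = uu v := I_n − (vt v)ᵀ(vt v)` (so `UUᵀX` zeroes the rows of `X`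
  indexed by `v` and keeps the others, `VᵀX = X.submatrix v id` extracts them).  Only the products
  `UUᵀ`, `Vᵀ`, `VVᵀ` occur in the theorem, so no matrix `U` is needed.
* The interval matrix `𝐗 = [L, Uu] ∈ 𝕀ℝ^{n×k}` is rendered by entrywise bounds `L i j ≤ X i j ≤ Uu i j`
  (predicate `InBox L Uu X`), nonempty: `∀ i j, L i j ≤ Uu i j`; `int(𝐗)` is entrywise STRICT
  inequality (`InInt L Uu X`; this is the interior in the sup-norm topology).
* (13.43)–(13.44): the interval evaluation `f(𝐗)` treats the two occurrences of `X` in (13.43)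
  independently and encloses each product outward; it therefore CONTAINS the exact two-variable
  range `{−R(AX̃ − λ̃X̃) + (I − R·B(X₁))·X₂ : X₁, X₂ ∈ 𝐗}` with `B(X₁) := (A − λ̃I)UUᵀ − (X̃ + UUᵀX₁)Vᵀ`
  (`borderMat`), and `⊆ int(𝐗)` is monotone under enlargement.  The typed hypothesis is this range
  statement (`∀ X₁ X₂ ∈ 𝐗, fMap … X₁ X₂ ∈ int(𝐗)`), which a passed machine test implies; it is
  exactly what the printed proof uses (Brouwer on the diagonal `X₁ = X₂`; Lemma 10.5 on the affine
  maps `X₂ ↦ z + (I − RB(X₁))X₂`).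
* Conclusions typed: `R` nonsingular; a fixed point `X̂ ∈ 𝐗`; `B(X̂)` nonsingular ("every matrix
  within 𝐁" is typed for the one member the proof uses, `borderMat … X̂`; the statement for all
  `X₁ ∈ 𝐗` is `det_borderMat_ne_zero`); `AŶ = ŶM̂` with `Ŷ := X̃ + UUᵀX̂ ∈ X̃ + UUᵀ𝐗`,
  `M̂ := λ̃I + VᵀX̂ ∈ λ̃I + Vᵀ𝐗`; "`Ŷ` has full rank" as injectivity of `Ŷ.mulVec` (equivalently: the
  `k` columns of `Ŷ` are linearly independent and span a `k`-dimensional `A`-invariant subspace on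
  which `A` acts by `M̂`).  The Jordan-form clause — `M̂` is similar to the restriction of `A` to that
  invariant subspace, hence its Jordan form is a principal part of that of `A` — is NOT typed beyond
  `AŶ = ŶM̂` + full rank (Mathlib v4.32 has no Jordan canonical form); typed instead is its spectral
  content used by certificates: every complex eigenvalue of `M̂` is an eigenvalue of `A`
  (`hasEigenvalue_of_repr`), and (13.46) in certificate form: every complex eigenvalue
  `μ` of `M̂` satisfies `|μ − λ̃| ≤ max_i (Δx)_i/x_i` for any entrywise bound `Δ ≥ |VᵀX̂|` and any
  positive test vector `x` (`eigenvalue_mem_disc_of_collatz`) — the Collatz–Wielandt upper bound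
  (10.61) of the Perron root `ϱ(Δ) ≥ ϱ(|VᵀX̂|)` replaces `ϱ` (weaker-or-equal radius, equal for the
  Perron vector `x`); the COUNT «`k` eigenvalues in the disc» (with multiplicity) is the Jordan clause
  and is not typed.
* Proof: as printed — Brouwer's fixed-point theorem in the form PROVED in the tree
  (`Literature.Analysis.Convex.exists_fixedPoint_of_isCompact_convex`, finite-dimensional compact
  convex sets) on the box `𝐗 ⊆ ℝ^{n×k}`; the nonsingularity of `R` and `B(X₁)` from the LINEAR
  verification theorem already typed (`RumpLinearSystem.thm_10_6`, Rump Thm 10.6 = the content of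
  Lemma 10.5 here) applied to one column of the affine map; the algebra (13.45) ⇒ `AŶ = ŶM̂`; full rank
  from `B(X̂)·V = −Ŷ` and `VᵀV = I_k`.

## Search record (TYPER LINT RULE)
`lean search` 'eigenpair|invariant subspace|verifyeig|Krawczyk.*eig' over `Literature/`: only the
simple-eigenpair file `ValidatedNumerics/KrawczykEigenpair.lean` (k = 1, bordered system with one
frozen component; Alefeld–Mayer Thm 18) — no cluster / invariant-subspace verification theorem;
certnum `typed/INDEX.tsv` row «verified SIMPLE eigenpair … Rump Thm 13.9 for k > 1 MISSING».
Brouwer: PROVED in tree (`Analysis/Convex/SchauderFixedPoint.lean`,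
`Topology/Euclidean/Brouwer*.lean`); Perron–Frobenius / spectral-radius monotonicity: not in Mathlib
or tree (hence the Collatz form of (13.46)).

AI-produced formalisation (cell certnum, seat certnum-lean-1, 2026-08-26).
-/

set_option autoImplicit false

open Set Matrix

namespace Literature.Analysis.ValidatedNumerics.RumpEigenCluster

variable {n k : Type*} [Fintype n] [Fintype k] [DecidableEq n] [DecidableEq k]

/-! ## The objects of Theorem 13.9 -/

/-- `Vᵀ ∈ ℝ^{k×n}` for the partition of the identity selected by `v : k → n`: row `c` is the unit
vector `e_{v c}` (so `VᵀX` extracts the rows `v c` of `X`, the «normalizing part»).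
[cite: Rump2010Verification, §13.4 (Figure 13.2)] -/
def vt (v : k → n) : Matrix k n ℝ := (1 : Matrix n n ℝ).submatrix v id

/-- `UUᵀ = I − VVᵀ ∈ ℝ^{n×n}`: the coordinate projector zeroing the rows selected by `v`.
[cite: Rump2010Verification, §13.4 (UUᵀ + VVᵀ = I_n)] -/
def uu (v : k → n) : Matrix n n ℝ := 1 - (vt v)ᵀ * vt v

/-- The bordered matrix `B(X₁) := (A − λ̃I)UUᵀ − (X̃ + UUᵀX₁)Vᵀ ∈ ℝ^{n×n}` of (13.43) (the members of
Rump's interval matrix `𝐁` as `X₁` ranges over `𝐗`). [cite: Rump2010Verification, Thm 13.9 (proof, 𝐁)] -/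
def borderMat (A : Matrix n n ℝ) (Xt : Matrix n k ℝ) (lam : ℝ) (v : k → n) (X₁ : Matrix n k ℝ) :
    Matrix n n ℝ :=
  (A - lam • (1 : Matrix n n ℝ)) * uu v - (Xt + uu v * X₁) * vt v

/-- Rump's map (13.43) with its two occurrences of `X` separated:
`f(X₁, X₂) := −R(AX̃ − λ̃X̃) + (I − R·B(X₁))·X₂`; the printed `f(X)` is `fMap … X X`.
[cite: Rump2010Verification, Thm 13.9 (13.43)] -/
def fMap (A R : Matrix n n ℝ) (Xt : Matrix n k ℝ) (lam : ℝ) (v : k → n) (X₁ X₂ : Matrix n k ℝ) :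
    Matrix n k ℝ :=
  -(R * (A * Xt - lam • Xt)) + (1 - R * borderMat A Xt lam v X₁) * X₂

/-- Membership in the interval matrix `𝐗 = [L, Uu]` (entrywise). [cite: Rump2010Verification, §13.4 (𝐗 ∈ 𝕀K^{n×k})] -/
def InBox (L Uu X : Matrix n k ℝ) : Prop := ∀ i j, L i j ≤ X i j ∧ X i j ≤ Uu i j

/-- Membership in `int(𝐗)`: entrywise strict inequality (the interior of the box in the sup-norm
topology of `ℝ^{n×k}`). [cite: Rump2010Verification, Thm 13.9 (13.44)] -/
def InInt (L Uu X : Matrix n k ℝ) : Prop := ∀ i j, L i j < X i j ∧ X i j < Uu i j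

/-! ## Algebra of the partition of the identity -/

omit [Fintype k] in
/-- `VᵀV = I_k` for an injective selection. [folklore] -/
private theorem vt_mul_vt_transpose (v : k → n) (hv : Function.Injective v) :
    vt v * (vt v)ᵀ = 1 := by
  ext a b
  simp [vt, Matrix.mul_apply, Matrix.one_apply, hv.eq_iff]

/-- `UUᵀ V = 0`: the projector kills the selected coordinates. [folklore] -/
private theorem uu_mul_vt_transpose (v : k → n) (hv : Function.Injective v) :
    uu v * (vt v)ᵀ = 0 := by
  rw [uu, Matrix.sub_mul, Matrix.one_mul, Matrix.mul_assoc, vt_mul_vt_transpose v hv,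
    Matrix.mul_one, sub_self]

/-- The «`k` columns equal to `−Ŷ`» step: `B(X₁) · V = −(X̃ + UUᵀX₁)`. [folklore] -/
private theorem borderMat_mul_vt_transpose (A : Matrix n n ℝ) (Xt : Matrix n k ℝ) (lam : ℝ)
    (v : k → n) (hv : Function.Injective v) (X₁ : Matrix n k ℝ) :
    borderMat A Xt lam v X₁ * (vt v)ᵀ = -(Xt + uu v * X₁) := by
  rw [borderMat, Matrix.sub_mul, Matrix.mul_assoc, uu_mul_vt_transpose v hv, Matrix.mul_zero,
    Matrix.mul_assoc, vt_mul_vt_transpose v hv, Matrix.mul_one, zero_sub]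

omit [Fintype k] [DecidableEq n] [DecidableEq k] in
/-- Column `c` of a product: `(M N)_{·c} = M (N_{·c})`. [folklore] -/
private theorem col_mul_eq_mulVec (M : Matrix n n ℝ) (N : Matrix n k ℝ) (c : k) :
    (fun i => (M * N) i c) = M *ᵥ fun j => N j c := by
  funext i
  simp [Matrix.mul_apply, Matrix.mulVec, dotProduct]

/-! ## The box as a compact convex set, and Brouwer -/

omit [Fintype n] [Fintype k] [DecidableEq n] [DecidableEq k] in
/-- The box `{X | InBox L Uu X}` is compact. [folklore] -/
private theorem isCompact_box (L Uu : Matrix n k ℝ) : IsCompact {X : Matrix n k ℝ | InBox L Uu X} := by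
  have h : {X : Matrix n k ℝ | InBox L Uu X} =
      Set.pi univ (fun i => Set.pi univ (fun j => Icc (L i j) (Uu i j))) := by
    ext X
    exact ⟨fun hX i _ j _ => hX i j, fun hX i j => hX i (Set.mem_univ i) j (Set.mem_univ j)⟩
  rw [h]
  exact isCompact_univ_pi fun i => isCompact_univ_pi fun j => isCompact_Icc

omit [Fintype n] [Fintype k] [DecidableEq n] [DecidableEq k] in
/-- The box is convex. [folklore] -/
private theorem convex_box (L Uu : Matrix n k ℝ) : Convex ℝ {X : Matrix n k ℝ | InBox L Uu X} := by
  intro X hX Y hY a b ha hb hab i j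
  have hX' := hX i j
  have hY' := hY i j
  simp only [Matrix.add_apply, Matrix.smul_apply, smul_eq_mul]
  have hL : L i j = a * L i j + b * L i j := by rw [← add_mul, hab, one_mul]
  have hU : Uu i j = a * Uu i j + b * Uu i j := by rw [← add_mul, hab, one_mul]
  constructor
  · nlinarith [mul_le_mul_of_nonneg_left hX'.1 ha, mul_le_mul_of_nonneg_left hY'.1 hb]
  · nlinarith [mul_le_mul_of_nonneg_left hX'.2 ha, mul_le_mul_of_nonneg_left hY'.2 hb]

omit [DecidableEq k] in
/-- Continuity of `X ↦ f(X, X)` (a polynomial map). [folklore] -/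
private theorem continuous_fMap_diag (A R : Matrix n n ℝ) (Xt : Matrix n k ℝ) (lam : ℝ) (v : k → n) :
    Continuous fun X : Matrix n k ℝ => fMap A R Xt lam v X X := by
  unfold fMap borderMat
  fun_prop

omit [DecidableEq k] in
/-- **Brouwer step** of the printed proof: if `f(X, X) ∈ int(𝐗)` (indeed `∈ 𝐗` suffices) for all
`X ∈ 𝐗 ≠ ∅`, then `f(·,·)` has a fixed point `X̂ ∈ 𝐗`. [cite: Rump2010Verification, Thm 13.9 (proof)] -/
theorem exists_fixedPoint (A R : Matrix n n ℝ) (Xt : Matrix n k ℝ) (lam : ℝ) (v : k → n)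
    {L Uu : Matrix n k ℝ} (hLU : ∀ i j, L i j ≤ Uu i j)
    (h : ∀ X, InBox L Uu X → InBox L Uu (fMap A R Xt lam v X X)) :
    ∃ Xh, InBox L Uu Xh ∧ fMap A R Xt lam v Xh Xh = Xh := by
  letI : NormedAddCommGroup (Matrix n k ℝ) := Matrix.normedAddCommGroup
  letI : NormedSpace ℝ (Matrix n k ℝ) := Matrix.normedSpace
  have hne : ({X : Matrix n k ℝ | InBox L Uu X}).Nonempty := ⟨L, fun i j => ⟨le_rfl, hLU i j⟩⟩
  obtain ⟨Xh, hXh, hfix⟩ :=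
    Literature.Analysis.Convex.exists_fixedPoint_of_isCompact_convex (isCompact_box L Uu)
      (convex_box L Uu) hne ⊤ (fun _ _ => trivial) (continuous_fMap_diag A R Xt lam v).continuousOn
      (fun X hX => h X hX)
  exact ⟨Xh, hXh, hfix⟩

/-! ## Nonsingularity of `R` and of the bordered matrices (the Lemma 10.5 step, via Thm 10.6) -/

/-- **`R` and every `B(X₁)`, `X₁ ∈ 𝐗`, are nonsingular** under (13.44) (printed: «(13.43), (13.44) and
Lemma 10.5 imply `R` and every matrix within `𝐁` to be non-singular»): fix `X₁` and one column index
`c`; the affine map `x ↦ (−R(AX̃ − λ̃X̃))_{·c} + (I − RB(X₁))x` sends the column box into its interior,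
so Rump's Theorem 10.6 (`RumpLinearSystem.thm_10_6`) applies.  Needs `k ≠ ∅`.
[cite: Rump2010Verification, Thm 13.9 (proof)] -/
theorem det_borderMat_ne_zero [Nonempty k] (A R : Matrix n n ℝ) (Xt : Matrix n k ℝ) (lam : ℝ)
    (v : k → n) {L Uu : Matrix n k ℝ} (hLU : ∀ i j, L i j ≤ Uu i j)
    (h : ∀ X₁ X₂, InBox L Uu X₁ → InBox L Uu X₂ → InInt L Uu (fMap A R Xt lam v X₁ X₂))
    {X₁ : Matrix n k ℝ} (hX₁ : InBox L Uu X₁) :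
    (borderMat A Xt lam v X₁).det ≠ 0 ∧ R.det ≠ 0 := by
  classical
  obtain ⟨c⟩ := (inferInstance : Nonempty k)
  -- column `c`: box `[l, u]`, right-hand side `b`, approximate inverse `R`, matrix `B(X₁)`
  set B := borderMat A Xt lam v X₁ with hB
  set b : n → ℝ := fun i => (-(A * Xt - lam • Xt)) i c with hb
  set l : n → ℝ := fun i => L i c with hl
  set u : n → ℝ := fun i => Uu i c with hu
  have hlu : l ≤ u := fun i => hLU i c
  have key : ∀ x ∈ Icc l u, R *ᵥ b + (1 - R * B) *ᵥ x ∈ interior (Icc l u) := by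
    intro x hx
    -- embed `x` as column `c` of the member `X₁` of the box
    obtain ⟨X₂, hX₂def⟩ : ∃ X₂ : Matrix n k ℝ, X₂ = Matrix.of (fun i j => if j = c then x i else X₁ i j) :=
      ⟨_, rfl⟩
    have hX₂ : InBox L Uu X₂ := by
      intro i j
      by_cases hj : j = c
      · subst hj; simp only [hX₂def, Matrix.of_apply, if_true]; exact ⟨hx.1 i, hx.2 i⟩
      · simp only [hX₂def, Matrix.of_apply, hj, if_false]; exact hX₁ i j
    have hint := h X₁ X₂ hX₁ hX₂
    -- column `c` of `f(X₁, X₂)` is `R b + (I − R B) x`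
    have hX₂c : (fun j => X₂ j c) = x := funext fun j => by simp [hX₂def, Matrix.of_apply]
    have hbc : (fun j => (-(A * Xt - lam • Xt)) j c) = -fun j => (A * Xt - lam • Xt) j c := rfl
    have hcol : (fun i => fMap A R Xt lam v X₁ X₂ i c) = R *ᵥ b + (1 - R * B) *ᵥ x := by
      have e1 : (fun i => (-(R * (A * Xt - lam • Xt)) : Matrix n k ℝ) i c) = R *ᵥ b := by
        have : (fun i => (-(R * (A * Xt - lam • Xt)) : Matrix n k ℝ) i c) =
            -fun i => (R * (A * Xt - lam • Xt) : Matrix n k ℝ) i c :=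
          rfl
        rw [this, col_mul_eq_mulVec, hb, hbc, Matrix.mulVec_neg]
      have e2 : (fun i => ((1 - R * B) * X₂ : Matrix n k ℝ) i c) = (1 - R * B) *ᵥ x := by
        rw [col_mul_eq_mulVec, hX₂c]
      rw [← e1, ← e2]
      funext i
      simp only [fMap, ← hB, Matrix.add_apply, Pi.add_apply]
    rw [← Set.pi_univ_Icc, interior_pi_set Set.finite_univ]
    simp only [interior_Icc, mem_univ_pi, mem_Ioo]
    intro i
    have hi : fMap A R Xt lam v X₁ X₂ i c = (R *ᵥ b + (1 - R * B) *ᵥ x : n → ℝ) i := congrFun hcol i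
    rw [← hi]
    exact hint i c
  obtain ⟨hBdet, hRdet, -⟩ := RumpLinearSystem.thm_10_6 B R b hlu key
  exact ⟨hBdet, hRdet⟩

/-! ## Theorem 13.9 -/

/-- **Rump 2010, Theorem 13.9** (verification of an eigenvalue cluster / invariant subspace; real
case, rendering described in the module docstring).  Let `A, R ∈ ℝⁿˣⁿ`, `X̃ ∈ ℝ^{n×k}` (`k ≥ 1`),
`λ̃ ∈ ℝ`, an injective selection `v : k → n` of normalising rows (`Vᵀ = vt v`, `UUᵀ = uu v`) and a
nonempty interval matrix `𝐗 = [L, Uu]`.  If the two-variable range of (13.43) satisfies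
`f(X₁, X₂) ∈ int(𝐗)` for all `X₁, X₂ ∈ 𝐗` (implied by the machine test `f(𝐗) ⊆ int(𝐗)` (13.44)),
then: `R` is nonsingular, and there is `X̂ ∈ 𝐗` such that, with `Ŷ := X̃ + UUᵀX̂ ∈ X̃ + UUᵀ𝐗` and
`M̂ := λ̃I_k + VᵀX̂ ∈ λ̃I_k + Vᵀ𝐗`: the bordered matrix `(A − λ̃I)UUᵀ − ŶVᵀ` is nonsingular,
`AŶ = ŶM̂`, and `Ŷ` has full column rank (`Ŷ.mulVec` is injective) — so the columns of `Ŷ` span a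
`k`-dimensional `A`-invariant subspace on which `A` is represented by `M̂`.
[cite: Rump2010Verification, Thm 13.9] -/
theorem thm_13_9 [Nonempty k] (A R : Matrix n n ℝ) (Xt : Matrix n k ℝ) (lam : ℝ)
    (v : k → n) (hv : Function.Injective v) {L Uu : Matrix n k ℝ} (hLU : ∀ i j, L i j ≤ Uu i j)
    (h : ∀ X₁ X₂, InBox L Uu X₁ → InBox L Uu X₂ → InInt L Uu (fMap A R Xt lam v X₁ X₂)) :
    R.det ≠ 0 ∧ ∃ Xh, InBox L Uu Xh ∧
      (borderMat A Xt lam v Xh).det ≠ 0 ∧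
      A * (Xt + uu v * Xh) = (Xt + uu v * Xh) * (lam • (1 : Matrix k k ℝ) + vt v * Xh) ∧
      Function.Injective (Xt + uu v * Xh).mulVec := by
  classical
  -- Brouwer: a fixed point `X̂ ∈ 𝐗` of `X ↦ f(X, X)`
  obtain ⟨Xh, hXh, hfix⟩ := exists_fixedPoint A R Xt lam v hLU
    (fun X hX i j => ⟨(h X X hX hX i j).1.le, (h X X hX hX i j).2.le⟩)
  -- nonsingularity of `R` and `B(X̂)`
  obtain ⟨hBdet, hRdet⟩ := det_borderMat_ne_zero A R Xt lam v hLU h hXh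
  refine ⟨hRdet, Xh, hXh, hBdet, ?_, ?_⟩
  · -- (13.45): `f(X̂, X̂) = X̂` and `R` nonsingular ⇒ `(AX̃ − λ̃X̃) + B(X̂) X̂ = 0`, then collect terms
    have hRunit : IsUnit R.det := isUnit_iff_ne_zero.2 hRdet
    have h45 : R * ((A * Xt - lam • Xt) + borderMat A Xt lam v Xh * Xh) = 0 := by
      have h1 : fMap A R Xt lam v Xh Xh - Xh = 0 := sub_eq_zero.2 hfix
      rw [fMap, Matrix.sub_mul, Matrix.one_mul] at h1
      rw [Matrix.mul_add, ← Matrix.mul_assoc]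
      calc R * (A * Xt - lam • Xt) + R * borderMat A Xt lam v Xh * Xh
          = -(-(R * (A * Xt - lam • Xt)) + (Xh - R * borderMat A Xt lam v Xh * Xh) - Xh) := by abel
        _ = 0 := by rw [h1, neg_zero]
    have h45' : (A * Xt - lam • Xt) + borderMat A Xt lam v Xh * Xh = 0 := by
      have := congrArg (fun M => R⁻¹ * M) h45
      simpa [← Matrix.mul_assoc, Matrix.nonsing_inv_mul _ hRunit] using this
    -- expand `B(X̂) X̂ = (A − λ̃I)UUᵀX̂ − (X̃ + UUᵀX̂)(VᵀX̂)` and collect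
    rw [borderMat] at h45'
    have : A * (Xt + uu v * Xh) - (Xt + uu v * Xh) * (lam • (1 : Matrix k k ℝ) + vt v * Xh) = 0 := by
      rw [← h45']
      simp only [Matrix.mul_add, Matrix.add_mul, Matrix.sub_mul, Matrix.smul_mul, Matrix.mul_smul,
        Matrix.one_mul, Matrix.mul_one, smul_add, Matrix.mul_assoc]
      abel
    exact sub_eq_zero.1 this
  · -- full rank: `B(X̂) V = −Ŷ`, `B(X̂)` nonsingular, `VᵀV = I`
    intro w₁ w₂ hw
    have hY : Xt + uu v * Xh = -(borderMat A Xt lam v Xh * (vt v)ᵀ) := by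
      rw [borderMat_mul_vt_transpose A Xt lam v hv Xh, neg_neg]
    have hBunit : IsUnit (borderMat A Xt lam v Xh).det := isUnit_iff_ne_zero.2 hBdet
    have h1 : (borderMat A Xt lam v Xh) *ᵥ ((vt v)ᵀ *ᵥ w₁) =
        (borderMat A Xt lam v Xh) *ᵥ ((vt v)ᵀ *ᵥ w₂) := by
      rw [Matrix.mulVec_mulVec, Matrix.mulVec_mulVec]
      have := congrArg Neg.neg hw
      rwa [hY, Matrix.neg_mulVec, Matrix.neg_mulVec, neg_neg, neg_neg] at this
    have h2 : (vt v)ᵀ *ᵥ w₁ = (vt v)ᵀ *ᵥ w₂ := by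
      have h2' := congrArg (fun y => (borderMat A Xt lam v Xh)⁻¹ *ᵥ y) h1
      simp only [Matrix.mulVec_mulVec, ← Matrix.mul_assoc, Matrix.nonsing_inv_mul _ hBunit,
        Matrix.one_mul] at h2'
      exact h2'
    have h3 := congrArg (fun y => vt v *ᵥ y) h2
    simp only [Matrix.mulVec_mulVec, vt_mul_vt_transpose v hv, Matrix.one_mulVec] at h3
    exact h3

/-! ## Spectral content: eigenvalues of `M̂` are eigenvalues of `A`; the disc (13.46) in Collatz form -/

omit [DecidableEq n] [DecidableEq k] in
/-- **Eigenvalues of the representation matrix are eigenvalues of `A`** (the spectral content of the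
Jordan clause): if `AŶ = ŶM̂` with `Ŷ.mulVec` injective, then every complex eigenvalue of `M̂` (an
eigenvalue of `M̂` viewed over `ℂ`) is a complex eigenvalue of `A`, with eigenvector `Ŷw`.
[cite: Rump2010Verification, Thm 13.9] -/
theorem hasEigenvalue_of_repr {A : Matrix n n ℝ} {Y : Matrix n k ℝ} {M : Matrix k k ℝ}
    (hAY : A * Y = Y * M) (hY : Function.Injective Y.mulVec) {μ : ℂ} {w : k → ℂ} (hw : w ≠ 0)
    (hMw : (M.map (algebraMap ℝ ℂ)) *ᵥ w = μ • w) :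
    (Y.map (algebraMap ℝ ℂ)) *ᵥ w ≠ 0 ∧
      (A.map (algebraMap ℝ ℂ)) *ᵥ ((Y.map (algebraMap ℝ ℂ)) *ᵥ w) = μ • ((Y.map (algebraMap ℝ ℂ)) *ᵥ w) := by
  have hAYc : A.map (algebraMap ℝ ℂ) * Y.map (algebraMap ℝ ℂ) = Y.map (algebraMap ℝ ℂ) * M.map (algebraMap ℝ ℂ) := by
    rw [← Matrix.map_mul, ← Matrix.map_mul, hAY]
  refine ⟨?_, ?_⟩
  · -- injectivity of `Y` over `ℝ` transfers to `ℂ` via real and imaginary parts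
    intro h0
    apply hw
    have hre : Y *ᵥ (fun j => (w j).re) = 0 := by
      funext i
      have := congrArg (fun z : n → ℂ => (z i).re) h0
      simpa [Matrix.mulVec, dotProduct, Matrix.map_apply, Complex.re_sum, Complex.mul_re] using this
    have him : Y *ᵥ (fun j => (w j).im) = 0 := by
      funext i
      have := congrArg (fun z : n → ℂ => (z i).im) h0
      simpa [Matrix.mulVec, dotProduct, Matrix.map_apply, Complex.im_sum, Complex.mul_im] using this
    have hre' : (fun j => (w j).re) = 0 := hY (by rw [hre, Matrix.mulVec_zero])
    have him' : (fun j => (w j).im) = 0 := hY (by rw [him, Matrix.mulVec_zero])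
    funext j
    apply Complex.ext
    · simpa using congrFun hre' j
    · simpa using congrFun him' j
  · rw [Matrix.mulVec_mulVec, hAYc, ← Matrix.mulVec_mulVec, hMw, Matrix.mulVec_smul]

/-- **The disc (13.46), Collatz form.** Let `M̂ = λ̃I + M̃` with `|M̃_{ij}| ≤ Δ_{ij}` (e.g. `Δ = |Vᵀ𝐗|`,
the entrywise maximum modulus of the interval matrix, and `M̃ = VᵀX̂`).  Then every complex eigenvalue
`μ` of `M̂` satisfies `|μ − λ̃| ≤ max_i (Δx)_i / x_i` for every positive test vector `x`
(Collatz 1942 / Rump (10.61): the right-hand side is an upper bound of the Perron root `ϱ(Δ) ≥ ϱ(|M̃|)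
≥ ϱ(M̃)`; printed radius `r = ϱ(|Vᵀ𝐗|)`).  Proof: at an index maximising `|w_i|/x_i` for an
eigenvector `w`.  [cite: Rump2010Verification, §13.4 (13.46)] -/
theorem eigenvalue_mem_disc_of_collatz {Mt : Matrix k k ℝ} {Δ : Matrix k k ℝ}
    (hΔ : ∀ i j, |Mt i j| ≤ Δ i j) {x : k → ℝ} (hx : ∀ i, 0 < x i) {r : ℝ}
    (hr : ∀ i, (Δ *ᵥ x) i ≤ r * x i) (lam : ℝ) {μ : ℂ} {w : k → ℂ} (hw : w ≠ 0)
    (hMw : ((lam • (1 : Matrix k k ℝ) + Mt).map (algebraMap ℝ ℂ)) *ᵥ w = μ • w) :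
    ‖μ - lam‖ ≤ r := by
  classical
  -- `M̃ w = (μ − λ̃) w`
  have hMt : (Mt.map (algebraMap ℝ ℂ)) *ᵥ w = (μ - lam) • w := by
    have h1 : ((lam • (1 : Matrix k k ℝ) + Mt).map (algebraMap ℝ ℂ)) =
        (lam : ℂ) • (1 : Matrix k k ℂ) + Mt.map (algebraMap ℝ ℂ) := by
      ext i j
      simp [Matrix.map_apply, Matrix.one_apply, apply_ite]
    rw [h1, Matrix.add_mulVec, Matrix.smul_mulVec, Matrix.one_mulVec] at hMw
    rw [sub_smul, ← hMw]
    abel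
  -- an index maximising `‖w i‖ / x i`
  haveI : Nonempty k := by
    by_contra hk
    rw [not_nonempty_iff] at hk
    exact hw (funext fun i => (IsEmpty.false i).elim)
  obtain ⟨i₀, -, hi₀⟩ :=
    Finset.exists_max_image Finset.univ (fun i => ‖w i‖ / x i) Finset.univ_nonempty
  set m := ‖w i₀‖ / x i₀ with hm
  have hwle : ∀ j, ‖w j‖ ≤ m * x j := fun j => by
    have hj := hi₀ j (Finset.mem_univ j)
    rwa [div_le_iff₀ (hx j)] at hj
  have hm_pos : 0 < m := by
    by_contra hle
    push Not at hle
    apply hw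
    funext j
    have h1 : ‖w j‖ ≤ 0 := by nlinarith [hwle j, hx j, norm_nonneg (w j)]
    exact norm_le_zero_iff.1 h1
  -- row `i₀` of `M̃ w = (μ − λ̃) w`
  have hrow : (μ - lam) * w i₀ = ∑ j, (Mt i₀ j : ℂ) * w j := by
    have := congrFun hMt i₀
    simp only [Matrix.mulVec, dotProduct, Matrix.map_apply, Pi.smul_apply, smul_eq_mul] at this
    exact this.symm
  have key : ‖μ - lam‖ * (m * x i₀) ≤ r * (m * x i₀) :=
    calc ‖μ - lam‖ * (m * x i₀) = ‖μ - lam‖ * ‖w i₀‖ := by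
          rw [hm, div_mul_cancel₀ _ (hx i₀).ne']
      _ = ‖∑ j, (Mt i₀ j : ℂ) * w j‖ := by rw [← norm_mul, hrow]
      _ ≤ ∑ j, ‖(Mt i₀ j : ℂ) * w j‖ := norm_sum_le _ _
      _ = ∑ j, |Mt i₀ j| * ‖w j‖ := Finset.sum_congr rfl fun j _ => by
          rw [norm_mul, Complex.norm_real, Real.norm_eq_abs]
      _ ≤ ∑ j, Δ i₀ j * (m * x j) := Finset.sum_le_sum fun j _ =>
          mul_le_mul (hΔ i₀ j) (hwle j) (norm_nonneg _) ((abs_nonneg _).trans (hΔ i₀ j))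
      _ = m * (Δ *ᵥ x) i₀ := by
          simp only [Matrix.mulVec, dotProduct, Finset.mul_sum]
          exact Finset.sum_congr rfl fun j _ => by ring
      _ ≤ m * (r * x i₀) := mul_le_mul_of_nonneg_left (hr i₀) hm_pos.le
      _ = r * (m * x i₀) := by ring
  exact le_of_mul_le_mul_right key (mul_pos hm_pos (hx i₀))

/-! ## (13.46) with the Perron radius (appended 2026-08-26)

CORRECTION of the search record in the module docstring above: Perron–Frobenius theory (Collatz–
Wielandt bounds, `ρ(B) ≤ ρ(|B|) ≤ ρ(A)` for `|B| ≤ A`, Horn–Johnson Thm 8.1.18) and the Jordan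
canonical form ARE in the tree — `Literature/LinearAlgebra/Matrix/{CollatzWielandtUpperBound,
SpectralRadiusMonotone, PerronRootNonnegative, JordanCanonicalForm}.lean` — only Mathlib lacks them.
Consequently the printed radius of (13.46), `r = ϱ(|Vᵀ𝐗|)`, is typable; the theorem below gives
it (for ANY entrywise bound `Δ ≥ |VᵀX̂|`, e.g. `Δ = |Vᵀ𝐗|`): every complex eigenvalue `μ` of
`M̂ = λ̃I + VᵀX̂` satisfies `‖μ − λ̃‖ ≤ ϱ(Δ)`, i.e. `|μ| ≤ ϱ(M̃) ≤ ϱ(|M̃|) ≤ ϱ(|Vᵀ𝐗|)` exactly as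
printed (Horn–Johnson Thm 8.1.18 supplies the two middle inequalities).  The Collatz form
`eigenvalue_mem_disc_of_collatz` above is its certificate-friendly upper bound (Rump (10.61)) and
coincides with the tree's `Literature.LinearAlgebra.Matrix.norm_eigenvalue_le_of_dominated_of_mulVec_le`
up to the shift by `λ̃` (near-duplicate, recorded in certnum typed/INDEX.tsv).  The COUNT «`k`
eigenvalues of `A` in the disc» (with multiplicity, via the Jordan clause) is still not typed. -/

/-- The spectrum of `Matrix.toLin' B` is the spectrum of `B` in the matrix algebra
(adapted from `SpectralRadiusMonotone`). [folklore] -/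
private theorem spectrum_toLin'_eq'' (B : Matrix k k ℂ) :
    spectrum ℂ (Matrix.toLin' B) = spectrum ℂ B :=
  AlgEquiv.spectrum_eq (Matrix.toLinAlgEquiv' : Matrix k k ℂ ≃ₐ[ℂ] _) B

/-- An eigen-equation witnesses a point of the spectrum: `B v = μ v`, `v ≠ 0` ⇒ `‖μ‖ ≤ ρ(B)`
(adapted from `SpectralRadiusMonotone`). [folklore] -/
private theorem nnnorm_le_spectralRadius_of_mulVec_eq' {B : Matrix k k ℂ} {μ : ℂ} {v : k → ℂ}
    (hv : v ≠ 0) (h : B *ᵥ v = μ • v) : (‖μ‖₊ : ENNReal) ≤ spectralRadius ℂ B := by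
  have hμ : Module.End.HasEigenvalue (Matrix.toLin' B) μ :=
    Module.End.hasEigenvalue_of_hasEigenvector
      (Module.End.hasEigenvector_iff.2
        ⟨Module.End.mem_eigenspace_iff.2 (by rw [Matrix.toLin'_apply, h]), hv⟩)
  have hmem : μ ∈ spectrum ℂ B := by
    rw [← spectrum_toLin'_eq'']; exact hμ.mem_spectrum
  exact le_iSup₂ (f := fun (z : ℂ) (_ : z ∈ spectrum ℂ B) => (‖z‖₊ : ENNReal)) μ hmem

/-- **Rump 2010 (13.46) with the Perron radius.**  Let `M̂ = λ̃I + M̃` with `|M̃_{ij}| ≤ Δ_{ij}` (e.g.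
`M̃ = VᵀX̂`, `Δ = |Vᵀ𝐗|` the entrywise maximum modulus of the interval matrix).  Then every complex
eigenvalue `μ` of `M̂` satisfies `‖μ − λ̃‖ ≤ ϱ(Δ)` (`ϱ` = spectral radius of `Δ` read in `M_k(ℂ)`,
its Perron root): `|μ − λ̃| ≤ ϱ(M̃) ≤ ϱ(|M̃|) ≤ ϱ(Δ)` by Horn–Johnson Thm 8.1.18
(`Literature.LinearAlgebra.Matrix.spectralRadius_le_of_norm_le`).
[cite: Rump2010Verification, §13.4 (13.46)] -/
theorem eigenvalue_mem_disc_spectralRadius {Mt Δ : Matrix k k ℝ} (hΔ : ∀ i j, |Mt i j| ≤ Δ i j)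
    (lam : ℝ) {μ : ℂ} {w : k → ℂ} (hw : w ≠ 0)
    (hMw : ((lam • (1 : Matrix k k ℝ) + Mt).map (algebraMap ℝ ℂ)) *ᵥ w = μ • w) :
    (‖μ - lam‖₊ : ENNReal) ≤ spectralRadius ℂ (Δ.map (algebraMap ℝ ℂ)) := by
  classical
  -- `M̃ w = (μ − λ̃) w`
  have hMt : (Mt.map (algebraMap ℝ ℂ)) *ᵥ w = (μ - lam) • w := by
    have h1 : ((lam • (1 : Matrix k k ℝ) + Mt).map (algebraMap ℝ ℂ)) =
        (lam : ℂ) • (1 : Matrix k k ℂ) + Mt.map (algebraMap ℝ ℂ) := by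
      ext i j
      simp [Matrix.map_apply, Matrix.one_apply, apply_ite]
    rw [h1, Matrix.add_mulVec, Matrix.smul_mulVec, Matrix.one_mulVec] at hMw
    rw [sub_smul, ← hMw]
    abel
  have h2 := nnnorm_le_spectralRadius_of_mulVec_eq' hw hMt
  refine h2.trans (Literature.LinearAlgebra.Matrix.spectralRadius_le_of_norm_le fun i j => ?_)
  rw [Matrix.map_apply, norm_algebraMap', Real.norm_eq_abs]
  exact hΔ i j

end Literature.Analysis.ValidatedNumerics.RumpEigenCluster
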